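import Summits.Parity.BatemanHorn.Theses.RoughValueTransport
import Literature.NumberTheory.Sieve.BatemanHornProofs
import HarnessLib

/-!
# Route `RoughValueTransport`, crux `RoughValueLaw` (stmt-Parity-11390), line
# `omega-class-shape-split`: the registered stub `stub_roughDecomposition`

`--supports` file of the checked skeleton
`Summits/Parity/BatemanHorn/Cruxes/RoughValueLaw/Lines/omega-class-shape-split.lean`
(crux `Summit.Parity.BatemanHorn.Theses.RoughValueTransport.RoughValueLaw`).  It PROVES the
registered stub `stub_roughDecomposition` verbatim: for a Bateman–Horn system `f = (f₁,…,f_k)` and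
a depth `u > 2` there is a constant `K` such that, for all large `x`, the jointly-rough count
`Φ_f(x,u) = #{1 ≤ n ≤ x : ∀ i, fᵢ(n) > 0 ∧ no prime p < ⌈x^{deg fᵢ/u}⌉ divides fᵢ(n)}`
differs from the sum of its Ω-cells `N_{f,r⃗}(x,u)` (`Ω(fᵢ(n)) = rᵢ` for every `i`) over the box
`r⃗ ∈ [1, ⌊u⌋]^k` by at most `K` (we take `K = ∑ᵢ deg fᵢ`).

## The argument

1. (`RoughDecomposition.abs_card_filter_sub_sum_le`, pure bookkeeping) the cells are the fibres of
   the Ω-vector `n ↦ (Ω(fᵢ(n)))ᵢ` on the rough set, so their sum over the box counts the rough `n`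
   whose Ω-vector lies in the box (`Finset.sum_card_fiberwise_eq_card_filter`), and
   `Φ − Σ cells = #{rough n : Ω-vector ∉ box}` (`Finset.card_filter_add_card_filter_not`).
2. (`RoughDecomposition.eventually_cardFactors_le_floor`) eventually in `x`, every rough `n ≤ x`
   has `Ω(fᵢ(n)) ≤ ⌊u⌋` in every coordinate: all prime factors of `m = fᵢ(n)` are
   `≥ N = ⌈x^{dᵢ/u}⌉`, so `N^{Ω(m)} ≤ m` (`List.pow_card_le_prod`), while
   `m ≤ (Σ_j |coeff_j|)·x^{dᵢ} < (x^{dᵢ/u})^{⌊u⌋+1} ≤ N^{⌊u⌋+1}` for `x` large, because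
   `(⌊u⌋+1)/u > 1` (`Nat.lt_floor_add_one`, `tendsto_rpow_atTop`).  This step is adapted (with
   `3 ↦ ⌊u⌋ + 1`) from the crux refuter's machine-checked `abs_eval_le`,
   `cardFactors_le_two_of_rough`, `eventually_cardFactors_le_two`
   (`Cruxes/RoughValueLaw/Disproof.lean`, refuter-cdisprove-stmt-Parity-11390-0; a Cruxes workfile
   is not importable here).
3. Hence an exceptional rough `n` has `Ω(fᵢ(n)) = 0` for some `i`, i.e. `fᵢ(n) = 1`
   (`ArithmeticFunction.cardFactors_eq_zero_iff_eq_zero_or_one`, `fᵢ(n) > 0`), and `fᵢ − 1` is a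
   non-zero polynomial (`deg fᵢ ≥ 1`, `IsBatemanHornSystem.natDegree_pos`) with at most `deg fᵢ`
   integer roots (`Polynomial.card_roots'`): `RoughDecomposition.card_filter_eval_eq_one_le`.

The edge `k = 0` needs no special treatment.  No definition and no new fact is introduced.
-/

noncomputable section

open Filter Finset Polynomial
open scoped BigOperators Topology ArithmeticFunction.Omega
open Literature.NumberTheory.Sieve

namespace Summit.Parity.BatemanHorn.Cruxes.RoughValueLaw.OmegaClassShapeSplit

namespace RoughDecomposition

/-- **Cells are fibres (bookkeeping).**  For a finset `s`, a predicate `P`, a vector-valued map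
`ω` and a finset `B` of vectors: the sub-count of `s.filter P` by the cells `{ω = r}`, `r ∈ B`,
misses exactly the members whose `ω`-vector lies outside `B`; so if those all belong to `T`, then
`|#(s.filter P) − Σ_{r ∈ B} #cell(r)| ≤ #T`. [folklore] -/
theorem abs_card_filter_sub_sum_le {α : Type*} {k : ℕ} (s : Finset α) (P : α → Prop)
    [DecidablePred P] (ω : α → Fin k → ℕ) (B : Finset (Fin k → ℕ)) (T : Finset α)
    (hT : ∀ n ∈ s, P n → ω n ∉ B → n ∈ T) :
    |((s.filter P).card : ℝ) -
        ∑ r ∈ B, ((s.filter (fun n => P n ∧ ∀ i, ω n i = r i)).card : ℝ)| ≤ T.card := by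
  have hcell : ∀ r : Fin k → ℕ,
      s.filter (fun n => P n ∧ ∀ i, ω n i = r i) = (s.filter P).filter (fun n => ω n = r) := by
    intro r
    rw [Finset.filter_filter]
    exact Finset.filter_congr fun n _ => by rw [funext_iff]
  have hsum : ∑ r ∈ B, (s.filter (fun n => P n ∧ ∀ i, ω n i = r i)).card =
      ((s.filter P).filter (fun n => ω n ∈ B)).card :=
    calc ∑ r ∈ B, (s.filter (fun n => P n ∧ ∀ i, ω n i = r i)).card
        = ∑ r ∈ B, ((s.filter P).filter (fun n => ω n = r)).card :=
          Finset.sum_congr rfl fun r _ => by rw [hcell r]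
      _ = ((s.filter P).filter (fun n => ω n ∈ B)).card :=
          Finset.sum_card_fiberwise_eq_card_filter _ _ _
  have hsplit := Finset.card_filter_add_card_filter_not (s := s.filter P) (fun n => ω n ∈ B)
  have hsub : (s.filter P).filter (fun n => ¬ ω n ∈ B) ⊆ T := by
    intro n hn
    simp only [Finset.mem_filter] at hn
    exact hT n hn.1.1 hn.1.2 hn.2
  have hle := Finset.card_le_card hsub
  have e : ((s.filter P).card : ℝ) - (((s.filter P).filter (fun n => ω n ∈ B)).card : ℝ) =
      (((s.filter P).filter (fun n => ¬ ω n ∈ B)).card : ℝ) := by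
    rw [← hsplit]
    push_cast
    ring
  rw [← Nat.cast_sum, hsum, e, Nat.abs_cast]
  exact_mod_cast hle

/-- **At most `deg P` arguments with `P(n) = 1`.**  For a polynomial `P ∈ ℤ[X]` of positive degree
and any finset `s` of natural numbers, `#{n ∈ s : P(n) = 1} ≤ deg P`: these `n` are integer roots
of the non-zero polynomial `P − 1`, of degree `deg P` (`Polynomial.card_roots'`). [folklore] -/
theorem card_filter_eval_eq_one_le (P : ℤ[X]) (hP : 0 < P.natDegree) (s : Finset ℕ) :
    (s.filter (fun n : ℕ => P.eval (n : ℤ) = 1)).card ≤ P.natDegree := by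
  have hdeg : (P - 1).natDegree = P.natDegree := by rw [← C_1, natDegree_sub_C]
  have hne : P - 1 ≠ 0 := by
    intro h0
    rw [h0, natDegree_zero] at hdeg
    omega
  calc (s.filter (fun n : ℕ => P.eval (n : ℤ) = 1)).card ≤ (P - 1).roots.toFinset.card := by
        refine Finset.card_le_card_of_injOn (fun n : ℕ => (n : ℤ)) (fun n hn => ?_)
          Nat.cast_injective.injOn
        have hn' := (Finset.mem_filter.mp (Finset.mem_coe.mp hn)).2
        rw [Finset.mem_coe, Multiset.mem_toFinset, mem_roots hne, IsRoot.def, eval_sub, eval_one,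
          hn', sub_self]
    _ ≤ Multiset.card (P - 1).roots := Multiset.toFinset_card_le _
    _ ≤ (P - 1).natDegree := card_roots' _
    _ = P.natDegree := hdeg

/-- Height bound: `|P(n)| ≤ (∑ |coeff|) · x^{deg P}` for `1 ≤ n ≤ x`. [folklore] -/
-- adapted from Cruxes/RoughValueLaw/Disproof.lean (refuter-cdisprove-stmt-Parity-11390-0)
theorem abs_eval_le (P : ℤ[X]) {x n : ℕ} (hn1 : 1 ≤ n) (hnx : n ≤ x) :
    |((P.eval (n : ℤ) : ℤ) : ℝ)| ≤
      (∑ j ∈ Finset.range (P.natDegree + 1), |(P.coeff j : ℝ)|) * (x : ℝ) ^ P.natDegree := by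
  have hx1 : (1 : ℝ) ≤ x := by exact_mod_cast hn1.trans hnx
  have hnx' : (n : ℝ) ≤ x := by exact_mod_cast hnx
  rw [eval_eq_sum_range, Int.cast_sum, Finset.sum_mul]
  refine (Finset.abs_sum_le_sum_abs _ _).trans (Finset.sum_le_sum fun j hj => ?_)
  rw [Finset.mem_range] at hj
  push_cast
  rw [abs_mul, abs_pow, abs_of_nonneg (by positivity : (0 : ℝ) ≤ n)]
  refine mul_le_mul_of_nonneg_left ?_ (abs_nonneg _)
  calc (n : ℝ) ^ j ≤ (x : ℝ) ^ j := by gcongr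
    _ ≤ (x : ℝ) ^ P.natDegree := pow_le_pow_right₀ hx1 (by omega)

/-- A positive integer all of whose prime factors are `≥ N` and which is `< N^{R+1}` has `Ω ≤ R`
(`N^{Ω(m)} ≤ m`, `List.pow_card_le_prod` on the prime factorisation). [folklore] -/
-- adapted from Cruxes/RoughValueLaw/Disproof.lean (refuter-cdisprove-stmt-Parity-11390-0):
-- `cardFactors_le_two_of_rough`, with `3 ↦ R + 1`
theorem cardFactors_le_of_rough {m N R : ℕ} (hm : m ≠ 0)
    (hrough : ∀ p : ℕ, p.Prime → p ∣ m → N ≤ p) (hlt : m < N ^ (R + 1)) :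
    Ω m ≤ R := by
  by_contra h
  have h' : R + 1 ≤ Ω m := by omega
  have h1 : N ^ Ω m ≤ m := by
    rw [ArithmeticFunction.cardFactors_apply]
    conv_rhs => rw [← Nat.prod_primeFactorsList hm]
    exact List.pow_card_le_prod _ _ fun p hp =>
      hrough p (Nat.prime_of_mem_primeFactorsList hp) (Nat.dvd_of_mem_primeFactorsList hp)
  have hN : 1 ≤ N := by
    rcases Nat.eq_zero_or_pos N with h0 | h0
    · subst h0; simp at hlt
    · exact h0
  have h2 : N ^ (R + 1) ≤ N ^ Ω m := Nat.pow_le_pow_right hN h'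
  omega

/-- **Eventually `Ω(fᵢ(n)) ≤ ⌊u⌋` on the rough set.**  For non-constant `fᵢ` and a depth `u > 0`:
once `x` is large, every `1 ≤ n ≤ x` whose values `fᵢ(n)` are all positive and free of primes
`< ⌈x^{deg fᵢ/u}⌉` has `Ω(fᵢ(n)) ≤ ⌊u⌋` in every coordinate (all prime factors are `≥ x^{dᵢ/u}`
while `fᵢ(n) ≪ x^{dᵢ} < x^{dᵢ(⌊u⌋+1)/u}`). [folklore] -/
-- adapted from Cruxes/RoughValueLaw/Disproof.lean (refuter-cdisprove-stmt-Parity-11390-0):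
-- `eventually_cardFactors_le_two`, with `3 ↦ ⌊u⌋₊ + 1`
theorem eventually_cardFactors_le_floor {k : ℕ} (f : Fin k → ℤ[X])
    (hdeg : ∀ i, 0 < (f i).natDegree) {u : ℝ} (hu0 : 0 < u) :
    ∀ᶠ x : ℕ in atTop, ∀ n ∈ Icc 1 x, (∀ i, 0 < (f i).eval (n : ℤ) ∧
      ∀ p ∈ range ⌈(x : ℝ) ^ (((f i).natDegree : ℝ) / u)⌉₊,
        p.Prime → ¬ ((p : ℤ) ∣ (f i).eval (n : ℤ))) →
      ∀ i, Ω ((f i).eval (n : ℤ)).toNat ≤ ⌊u⌋₊ := by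
  -- for each coordinate, eventually `B_i x^{d_i} < (x^{d_i/u})^(⌊u⌋+1)`
  have hcoord : ∀ i, ∀ᶠ x : ℕ in atTop,
      (∑ j ∈ range ((f i).natDegree + 1), |((f i).coeff j : ℝ)|) * (x : ℝ) ^ (f i).natDegree
        < ((x : ℝ) ^ (((f i).natDegree : ℝ) / u)) ^ (⌊u⌋₊ + 1) := by
    intro i
    set d : ℕ := (f i).natDegree with hd
    set B : ℝ := ∑ j ∈ range (d + 1), |((f i).coeff j : ℝ)| with hB
    have hdpos : (0 : ℝ) < d := by exact_mod_cast hdeg i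
    have huR : u < ((⌊u⌋₊ + 1 : ℕ) : ℝ) := by push_cast; exact Nat.lt_floor_add_one u
    have hexp : 0 < (d : ℝ) * (((⌊u⌋₊ + 1 : ℕ) : ℝ) / u - 1) := by
      apply mul_pos hdpos
      rw [sub_pos, lt_div_iff₀ hu0, one_mul]
      exact huR
    have ht : Tendsto (fun x : ℕ => (x : ℝ) ^ ((d : ℝ) * (((⌊u⌋₊ + 1 : ℕ) : ℝ) / u - 1)))
        atTop atTop :=
      (tendsto_rpow_atTop hexp).comp tendsto_natCast_atTop_atTop
    filter_upwards [ht.eventually_gt_atTop B, eventually_gt_atTop 0] with x hx hx0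
    have hx0' : (0 : ℝ) < x := by exact_mod_cast hx0
    have e1 : ((x : ℝ) ^ ((d : ℝ) / u)) ^ (⌊u⌋₊ + 1) =
        (x : ℝ) ^ ((d : ℝ) * (((⌊u⌋₊ + 1 : ℕ) : ℝ) / u - 1)) * (x : ℝ) ^ d := by
      rw [← Real.rpow_natCast ((x : ℝ) ^ ((d : ℝ) / u)) (⌊u⌋₊ + 1), ← Real.rpow_mul hx0'.le,
        ← Real.rpow_natCast (x : ℝ) d, ← Real.rpow_add hx0']
      congr 1
      push_cast
      ring
    rw [e1]
    exact mul_lt_mul_of_pos_right hx (by positivity)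
  filter_upwards [eventually_all.mpr hcoord] with x hx n hn hgood i
  rw [Finset.mem_Icc] at hn
  obtain ⟨hn1, hnx⟩ := hn
  obtain ⟨hpos, hsift⟩ := hgood i
  set m : ℕ := ((f i).eval (n : ℤ)).toNat with hm
  have hmz : (m : ℤ) = (f i).eval (n : ℤ) := Int.toNat_of_nonneg hpos.le
  have hm0 : m ≠ 0 := by
    intro h0; rw [h0] at hmz; simp at hmz; linarith
  set N : ℕ := ⌈(x : ℝ) ^ (((f i).natDegree : ℝ) / u)⌉₊ with hN
  refine cardFactors_le_of_rough (N := N) hm0 (fun p hp hpm => ?_) ?_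
  · by_contra hlt
    have hlt' : p < N := by omega
    refine hsift p (Finset.mem_range.mpr hlt') hp ?_
    rw [← hmz]
    exact_mod_cast hpm
  · -- m ≤ B x^d < (x^{d/u})^(⌊u⌋+1) ≤ N^(⌊u⌋+1)
    have h1 : (m : ℝ) ≤ (∑ j ∈ range ((f i).natDegree + 1), |((f i).coeff j : ℝ)|) *
        (x : ℝ) ^ (f i).natDegree := by
      have := abs_eval_le (f i) hn1 hnx
      rw [← hmz] at this
      push_cast at this
      exact le_trans (le_abs_self _) this
    have h2 : ((x : ℝ) ^ (((f i).natDegree : ℝ) / u)) ^ (⌊u⌋₊ + 1) ≤ (N : ℝ) ^ (⌊u⌋₊ + 1) :=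
      pow_le_pow_left₀ (by positivity) (Nat.le_ceil _) _
    have h3 : (m : ℝ) < (N : ℝ) ^ (⌊u⌋₊ + 1) := lt_of_le_of_lt h1 ((hx i).trans_le h2)
    exact_mod_cast h3

end RoughDecomposition

/-- **stub_roughDecomposition** (registered stub of the skeleton
`Cruxes/RoughValueLaw/Lines/omega-class-shape-split.lean`, crux stmt-Parity-11390).
**`Φ_f(x,u) = Σ_{r⃗ ∈ [1,⌊u⌋]^k} N_{f,r⃗}(x,u) + O(1)`.**  For a Bateman–Horn system `f` and a depth
`u > 2` there is `K` (namely `Σᵢ deg fᵢ`) with, for all large `x`,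
`|Φ_f(x,u) − Σ_{r⃗ ∈ [1,⌊u⌋]^k} #{rough n ≤ x : Ω(fᵢ(n)) = rᵢ ∀ i}| ≤ K`: the cells partition the
rough set by the Ω-vector, `Ω(fᵢ(n)) ≤ ⌊u⌋` eventually
(`RoughDecomposition.eventually_cardFactors_le_floor`), and `Ω(fᵢ(n)) = 0` forces `fᵢ(n) = 1`,
at most `deg fᵢ` values of `n` (`RoughDecomposition.card_filter_eval_eq_one_le`). [folklore] -/
theorem stub_roughDecomposition :
    ∀ (k : ℕ) (f : Fin k → ℤ[X]), IsBatemanHornSystem f → ∀ u : ℝ, 2 < u → ∃ K : ℝ, ∀ᶠ x : ℕ in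
      atTop, |(((Icc 1 x).filter (fun n : ℕ => ∀ i, 0 < (f i).eval (n : ℤ) ∧ ∀ p ∈ range ⌈(x :
      ℝ) ^ (((f i).natDegree : ℝ) / u)⌉₊, p.Prime → ¬ ((p : ℤ) ∣ (f i).eval (n : ℤ)))).card : ℝ)
      - ∑ r ∈ Fintype.piFinset (fun _ : Fin k => Icc 1 ⌊u⌋₊), (((Icc 1 x).filter (fun n : ℕ =>
      (∀ i, 0 < (f i).eval (n : ℤ) ∧ ∀ p ∈ range ⌈(x : ℝ) ^ (((f i).natDegree : ℝ) / u)⌉₊,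
      p.Prime → ¬ ((p : ℤ) ∣ (f i).eval (n : ℤ))) ∧ ∀ i, ArithmeticFunction.cardFactors ((f
      i).eval (n : ℤ)).toNat = r i)).card : ℝ)| ≤ K := by
  intro k f hf u hu
  refine ⟨((∑ i, (f i).natDegree : ℕ) : ℝ), ?_⟩
  filter_upwards [RoughDecomposition.eventually_cardFactors_le_floor f hf.natDegree_pos
    (zero_lt_two.trans hu)] with x hx
  refine (RoughDecomposition.abs_card_filter_sub_sum_le (Icc 1 x) _
    (fun (n : ℕ) (i : Fin k) => Ω ((f i).eval (n : ℤ)).toNat) _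
    (Finset.univ.biUnion fun i => (Icc 1 x).filter (fun n : ℕ => (f i).eval (n : ℤ) = 1))
    (fun n hn hP hB => ?_)).trans ?_
  · -- an exceptional rough `n` has some `fᵢ(n) = 1`
    rw [Fintype.mem_piFinset] at hB
    push Not at hB
    obtain ⟨i, hi⟩ := hB
    rw [Finset.mem_Icc, not_and_or, not_le, not_le] at hi
    have hle := hx n hn hP i
    have h0 : Ω ((f i).eval (n : ℤ)).toNat = 0 := by omega
    have hpos := (hP i).1
    rw [Finset.mem_biUnion]
    refine ⟨i, Finset.mem_univ _, Finset.mem_filter.mpr ⟨hn, ?_⟩⟩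
    rcases ArithmeticFunction.cardFactors_eq_zero_iff_eq_zero_or_one.mp h0 with h | h <;> omega
  · -- `#⋃ᵢ {n ≤ x : fᵢ(n) = 1} ≤ Σᵢ deg fᵢ`
    exact_mod_cast Finset.card_biUnion_le.trans (Finset.sum_le_sum fun i _ =>
      RoughDecomposition.card_filter_eval_eq_one_le (f i) (hf.natDegree_pos i) _)

end Summit.Parity.BatemanHorn.Cruxes.RoughValueLaw.OmegaClassShapeSplit

end
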